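import Summits.QuantumFields.YangMills.Theorems.BalabanUVNodesN07CritMultiScaleChainFree
import Literature.MathematicalPhysics.QuantumFieldTheory.Balaban1983to89.Node00.GenSetVsLamBond

/-!
# NODE N07 ([15] = [Balaban1985Variational]) — MODULE 37a: PRINT'S MULTI-SCALE CONSTRAINT FAMILY (2.3)∕(7) IS CHAIN-FREE;
# THE TANGENT FORM (82) AND THE CURRENT FORM (141) ON PRINT'S MULTI-SCALE FIBRE, WITH NO CHART, NO CORRECTOR AND NO CHAIN HYPOTHESIS

Cell `pub-ymgap`, seat `pub-ymgap-dag-n07-e` generation 16 (R141 (C), DAG node N07; INBOX INTENT-37).  `--kind proof --supports stmt-QuantumFields-20541 --as helper`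
(K0⁷; count-neutral).

THE POINT.  Module 35j (`…N07CritMultiScaleChainFree`) proved, for an ARBITRARY level-indexed family `Λ` of pinned bonds, that CHAIN-FREENESS (every level `ℓ`
admits a tower through `Λ ℓ`, closed downwards under the central crossing bond `β = centralBond`, disjoint from every lower `Λ j`) gives corrected fibre curves along
every joint-kernel ray, hence «curve-critical ⇒ (82) tangent-critical» and the current form (141) — and located (HOME `LOCATED-MULTISCALE-FIBRE.md` § A) that the
tree's reading (b) of [III] (2.2) (`bondsOf ∘ genSet`: bonds MEETING `Γ_j`) is NOT chain-free at the `Γ_j ↔ Ω_{j+1}` connectors.  The literature desk's ruling of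
record (lit-balaban ME #35, bus 2026-08-27 l.24840; [15] (7) p.278: «a bond with an end-point in the deeper region does not belong to Λ_j») is that print's
constraint family is [Balaban1984PropagatorsII] (2.3): `Λ_j` = bonds with AT LEAST ONE end-point in `Ω_j^{(j)}` and NO end-point deep (inside `Ω_{j+1}`) — in the tree
the EXISTING object `B6SectADomainsV1.Domains.LamBond` (width seat n07-w2's dictionary `Node00.GenSetVsLamBond`).  THIS FILE: that family IS chain-free, for EVERY
`D : Domains P` (§1, ★★ `chainFree_lamBond`) — the tower at level `ℓ` is «one end-point's level-`ℓ` block lies in `Ω_ℓ^{(ℓ)}`»: it contains `Λ_ℓ`, is closed under `β`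
because the end-points of `β(c)` lie in the blocks `B(c₋)`, `B(c₊)` (`blockOf_src∕tgt_centralBond`), and misses every lower `Λ_j` because, by the nesting (2.1), such an
end-point is DEEP at level `j`.  Hence (§2) ★★★ `exists_fibreCurve_of_lamBond` — fibre curves with prescribed joint-kernel velocity on print's multi-scale fibre, every
torus, every `N`, smallness = the route `UnitScaleTilt` corrector's — and at NODE 00's objects (§3) ★★★ `hasDerivAt_wilsonAction4_expChart_of_critLam` (curve-critical on
the (2.3) fibre ⇒ `d∕dt A(U·exp tX)|₀ = 0` on the joint kernel), ★★★ `sum_re_trace_covDivT_eq_zero_of_critLam` ((141) in [B8] (1.2)'s letters), with the criticality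
hypothesis SPELLED OUT (the text of `Node00.IsCritOnFibre` with `AgreeOn 𝐁` replaced by agreement on `D.LamBond`; no definition — which predicate K0's statements carry
is plan ∕ r12's).  Dictionary (§3): ★ `isCritOnFibre_genSet_of_critLam` — criticality on print's (LARGER) fibre implies stub 1's `IsCritOnFibre` on the (b) fibre of
`genSet`; ★ `critLam_whole_iff` — with all domains the whole torus ([B6] p.224's admitted case, `Domains.whole k`) the (2.3) fibre is the one-scale pin and the
predicate IS g2's `IsCritOfRecord` (35c∕35e's setting recovered).

HONEST FRAMING: count-neutral kernel bookkeeping over 35h∕35i∕35j and n07-w2's dictionary; smallness side conditions (`stokesConst·t₀ < |I|⁻¹∕16`, `< δ_N`) are the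
route `UnitScaleTilt` corrector's; nothing of [15] Sects. B–F is proved; the (b) fibre of stub 1 is NOT shown chain-free (it is not, § A) — only the ⇐ direction
holds there unconditionally (module 37b); stub 1 ∕ K0⁷ NOT closed; N07 NOT discharged (5∕27); one finite T⁴ programme at fixed ε — NOT continuum ∕ ℝ⁴ ∕ OS ∕
mass gap ∕ Clay.  No `sorry`, no `def`, no `instance`, no `notation`.
References: T. Bałaban, CMP **102** (1985) 277–309 [Balaban1985Variational] ((3),(5)–(7) p.278, (82)–(83) p.290, (141) p.299, Prop. 8 p.304); CMP **96** (1984)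
223–250 [Balaban1984PropagatorsII] ((2.1)–(2.3) p.224); CMP **119** (1988) 243–285 [Balaban1988Convergent] ((2.2), (2.10)–(2.12) pp.255–256); CMP **109** (1987)
249–301 [Balaban1987RG1] ((0.1) p.251, (0.4) p.253); CMP **95** (1984) 17–40 [Balaban1984PropagatorsI] ((1.7) p.18, (1.18) p.20); CMP **99** (1985) 75–102
[Balaban1985RegularSpaces] ((1.1)–(1.2) p.76).
-/

noncomputable section

open scoped Matrix.Norms.L2Operator Topology BigOperators
open Filter Asymptotics Function NormedSpace

namespace Summit.QuantumFields.YangMills.BalabanUVNodes.N07CritMultiScaleLamBond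

open Literature.MathematicalPhysics.QuantumFieldTheory.Balaban1983to89
open Literature.MathematicalPhysics.QuantumFieldTheory.Balaban1983to89.T4Continuum (T4Family)
open Literature.MathematicalPhysics.QuantumFieldTheory.Balaban1983to89.B15DeterminingSets
open Literature.MathematicalPhysics.QuantumFieldTheory.Balaban1983to89.B5Eq118OneStroke (iterBlockOf iterBlockOf_succ)
open Literature.MathematicalPhysics.QuantumFieldTheory.Balaban1983to89.B6SectADomainsV1 (Domains)
open Literature.MathematicalPhysics.QuantumFieldTheory.BalabanImbrieJaffe1984to88.BIJ88RT51Background (iterBlockOf_embIter)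
open Literature.MathematicalPhysics.QuantumFieldTheory.Balaban1983to89.AveragingRT (lineSite line lineSite_eq_lo lineSite_eq_hi lineSite_succ half_lt)
open Literature.MathematicalPhysics.QuantumFieldTheory.Balaban1983to89.BlockAveraging
open Literature.MathematicalPhysics.QuantumFieldTheory.Balaban1983to89.BlockAveragingHaarAC (centralBond)
open Literature.MathematicalPhysics.QuantumFieldTheory.Balaban1983to89.BlockAveragingEMLHaarAC (emlWeight)
open Literature.MathematicalPhysics.QuantumFieldTheory.Balaban1983to89.ExpMeanLog (expMeanLogSU deltaSU)
open Literature.MathematicalPhysics.QuantumFieldTheory.Balaban1983to89.T4AdjointCovarianceUnitary (lieSU)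
open Literature.MathematicalPhysics.QuantumFieldTheory.Balaban1983to89.B10Eq27TorusAxialLog (toUField unitsField)
open Literature.MathematicalPhysics.QuantumFieldTheory.Balaban1983to89.B10Eq68TorusRegularity (covDivT)
open Literature.MathematicalPhysics.QuantumFieldTheory.Balaban1983to89.Node00
open Summit.QuantumFields.YangMills.Theorems.BlockAvgCorrector (stokesConst)
open Summit.QuantumFields.YangMills.BalabanUVNodes.N07CritMultiScaleChainFree (exists_fibreCurve_of_chainFree)
open Summit.QuantumFields.YangMills.BalabanUVNodes.N07CritCurrentForm (sum_re_trace_covDivT_eq_zero_of_hasDerivAt_zero)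

/-! ## §1  The central crossing bond joins `B(c₋)` to `B(c₊)`; the (2.3) family is chain-free -/

section Geometry

variable {P : Params}

/-- The source `emb c₋ + ((L−1)∕2)e_μ` of the central crossing bond `β(c)` lies in the block `B(c₋)` (first half of the straight line of `c`).
[cite: Balaban1984PropagatorsI, (1.7) p.18; Balaban1987RG1, (0.1) p.251 (bookkeeping)] -/
theorem blockOf_src_centralBond {j : ℕ} (hj : j + 1 ≤ P.m + P.K) (c : PBond P (j + 1)) : blockOf (centralBond c).src = c.src := by
  show blockOf (lineSite c ((P.L - 1) / 2)) = c.src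
  rw [lineSite_eq_lo hj c le_rfl, Site.blockOf_blockSite hj]

/-- The target `emb c₋ + ((L+1)∕2)e_μ` of `β(c)` lies in the block `B(c₊)` (second half of the straight line of `c`). [cite: Balaban1984PropagatorsI, (1.7) p.18; Balaban1987RG1, (0.1) p.251 (bookkeeping)] -/
theorem blockOf_tgt_centralBond {j : ℕ} (hj : j + 1 ≤ P.m + P.K) (c : PBond P (j + 1)) : blockOf (centralBond c).tgt = c.tgt := by
  have h : (centralBond c).tgt = lineSite c ((P.L - 1) / 2 + 1) := by
    show (line c ((P.L - 1) / 2)).tgt = lineSite c ((P.L - 1) / 2 + 1)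
    rw [lineSite_succ]; rfl
  have h2 : (P.L - 1) / 2 + 1 ≤ P.L := half_lt P
  rw [h, lineSite_eq_hi hj c (Nat.lt_succ_self _) h2, Site.blockOf_blockSite hj]

/-- Two fine sites with the same `n`-fold block point have the same `n′`-fold block point for every `n′ ≥ n` (generic-`Params` twin of the PV-only
`B6Ineq2142KLevelV1.iterBlockOf_eq_of_le`). [cite: Balaban1984PropagatorsI, (1.18) p.20 (bookkeeping)] -/
theorem iterBlockOf_congr_of_le {n n' : ℕ} (hnn : n ≤ n') {x x' : Site P 0} (h : iterBlockOf n x = iterBlockOf n x') :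
    iterBlockOf n' x = iterBlockOf n' x' := by
  induction hnn with
  | refl => exact h
  | step _ ih => rw [iterBlockOf_succ, iterBlockOf_succ, ih]

/-- The `ℓ`-fold block point of the CENTRE of a level-`i` site `e` is the `ℓ`-fold block point of the centre of its block `B(e)`'s label, `i + 1 ≤ ℓ`
(standing range `i + 1 ≤ m + K`). [cite: Balaban1987RG1, (0.1) p.251; Balaban1984PropagatorsI, (1.18) p.20 (bookkeeping)] -/
theorem iterBlockOf_embIter_eq_of_blockOf {i ℓ : ℕ} (hi : i + 1 ≤ P.m + P.K) (hiℓ : i + 1 ≤ ℓ) (e : Site P i) :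
    iterBlockOf ℓ (embIter i e) = iterBlockOf ℓ (embIter (i + 1) (blockOf e)) := by
  apply iterBlockOf_congr_of_le hiℓ
  rw [iterBlockOf_succ, iterBlockOf_embIter i (by omega) e, iterBlockOf_embIter (i + 1) hi]

/-- ★★ **PRINT'S CONSTRAINT FAMILY (2.3) IS CHAIN-FREE.**  For every domain family `D` ((2.1): `Ω_{j+1} ⊆ Ω_j`, block-measurable) and every level `ℓ ≤ k`, the
tower `T i := {b | an end-point of b has its level-ℓ block in Ω_ℓ^{(ℓ)}}` contains `Λ_ℓ` (a (2.3)-bond has an end-point in `Ω_ℓ^{(ℓ)}`), is closed downwards under the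
central crossing bond (`β(c)`'s end-points lie in `B(c₋)`, `B(c₊)`), and is disjoint from every `Λ_j`, `j < ℓ` (such an end-point is DEEP at level `j` by nesting, and
(2.3)-bonds have no deep end-point) — exactly the hypothesis `hCF` of 35j `exists_fibreCurve_of_chainFree`.
[cite: Balaban1984PropagatorsII, (2.1)–(2.3) p.224; Balaban1985Variational, (7) p.278; Balaban1988Convergent, (2.2), (2.10) pp.255–256] -/
theorem chainFree_lamBond (D : Domains P) :
    ∀ ℓ, ℓ ≤ D.k → ∃ T : (i : ℕ) → Set (PBond P i), {b | D.LamBond ℓ b} ⊆ T ℓ ∧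
      (∀ i, i < ℓ → ∀ c : PBond P (i + 1), c ∈ T (i + 1) → centralBond c ∈ T i) ∧
      ∀ j, j < ℓ → Disjoint (T j) {b | D.LamBond j b} := by
  intro ℓ hℓ
  have hℓ' : ℓ ≤ P.m + P.K := hℓ.trans D.hk
  refine ⟨fun i => {b | D.InOm ℓ (embIter i b.src) ∨ D.InOm ℓ (embIter i b.tgt)}, ?_, ?_, ?_⟩
  · rintro b ⟨hb | hb, _, _⟩
    · exact Or.inl ((inOm_embIter_iff D hℓ' b.src).2 hb)
    · exact Or.inr ((inOm_embIter_iff D hℓ' b.tgt).2 hb)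
  · intro i hi c hc
    have hi' : i + 1 ≤ P.m + P.K := by omega
    rcases hc with h | h
    · refine Or.inl ?_
      show iterBlockOf ℓ (embIter i (centralBond c).src) ∈ D.Om ℓ
      rw [iterBlockOf_embIter_eq_of_blockOf hi' (Nat.succ_le_of_lt hi), blockOf_src_centralBond hi']
      exact h
    · refine Or.inr ?_
      show iterBlockOf ℓ (embIter i (centralBond c).tgt) ∈ D.Om ℓ
      rw [iterBlockOf_embIter_eq_of_blockOf hi' (Nat.succ_le_of_lt hi), blockOf_tgt_centralBond hi']
      exact h
  · intro j hj
    rw [Set.disjoint_left]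
    rintro b (h | h) ⟨_, hs, ht⟩
    · exact D.not_inOm_of_not_deep hj (by rw [iterBlockOf_embIter j (by omega)]; exact hs) h
    · exact D.not_inOm_of_not_deep hj (by rw [iterBlockOf_embIter j (by omega)]; exact ht) h

/-- With all domains the whole torus up to level `k` ([B6] p.224's admitted case, `Domains.whole k`), the (2.3) family is the ONE-SCALE PIN: `Λ_j = ∅` for `j ≠ k` and
`Λ_k` = all bonds. [cite: Balaban1984PropagatorsII, (2.1), (2.3) p.224] -/
theorem lamBond_whole_iff {k : ℕ} (hk : k ≤ P.m + P.K) {j : ℕ} (c : PBond P j) : (Domains.whole k hk).LamBond j c ↔ j = k := by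
  simp only [Domains.LamBond, Domains.Deep, Domains.whole]
  by_cases h1 : j ≤ k <;> by_cases h2 : j + 1 ≤ k <;> simp [h1, h2] <;> omega

end Geometry

/-! ## §2  Fibre curves with prescribed joint-kernel velocity on print's multi-scale fibre (every torus, every `N`) -/

section Ascend

variable {P : Params} {N : ℕ} [NeZero N]

/-- ★★★ **FIBRE CURVES ON PRINT'S (2.3) MULTI-SCALE FIBRE.**  On a torus `P`, for a domain family `D` and a multi-scale datum `W`, let `U` lie on the fibre
«`Ū^j(U) = W_j` on `Λ_j` for every `j`» with `t₀`-small iterated averages below `k` (`stokesConst·t₀ < |I|⁻¹∕16`, `< δ_N`).  Then for every JOINT-KERNEL direction `X`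
(the velocity of `Ū^j(U·exp tX)(c)` at `0` vanishes at every `(2.3)`-bond `c`) there is a curve `γ` through `U` with bond-wise velocity `U_b·X_b` staying on the fibre
for `t` near `0` — 35j's ascending selective correction, the chain hypothesis DISCHARGED by §1.  No chart (47), no corrector hypothesis, no lift hypothesis.
[cite: Balaban1985Variational, (3),(5)–(7) p.278, (82)–(83) p.290; Balaban1984PropagatorsII, (2.3) p.224; Balaban1987RG1, (0.4) p.253] -/
theorem exists_fibreCurve_of_lamBond {t₀ : ℝ} (ht₀ : 0 < t₀) (hst : stokesConst P * t₀ < emlWeight P / 16)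
    (hstδ : stokesConst P * t₀ < deltaSU (Fin N)) (D : Domains P) (W : (j : ℕ) → GaugeField P j (SU N)) {U : GaugeField P 0 (SU N)}
    (hsm : ∀ i, i < D.k → PlaqSmall t₀ (Averaging.iter (fun i => blockAvg (P := P) (j := i) (expMeanLogSU (n := Fin N))) i U))
    (hfib : ∀ j (c : PBond P j), D.LamBond j c → Averaging.iter (fun i => blockAvg (P := P) (j := i) (expMeanLogSU (n := Fin N))) j U c = W j c)
    {X : PBond P 0 → lieSU (Fin N)}
    (hX : ∀ j (c : PBond P j), D.LamBond j c → HasDerivAt (fun t : ℝ => ((Averaging.iter (fun i => blockAvg (P := P) (j := i) (expMeanLogSU (n := Fin N))) j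
      (expChart U (t • X)) c : SU N) : Matrix (Fin N) (Fin N) ℂ)) 0 0) :
    ∃ γ : ℝ → GaugeField P 0 (SU N), γ 0 = U ∧
      (∀ b : PBond P 0, HasDerivAt (fun t => ((γ t b : SU N) : Matrix (Fin N) (Fin N) ℂ)) ((U b : Matrix (Fin N) (Fin N) ℂ) * (X b : Matrix (Fin N) (Fin N) ℂ)) 0) ∧
      ∀ᶠ t in 𝓝 (0 : ℝ), ∀ j (c : PBond P j), D.LamBond j c →
        Averaging.iter (fun i => blockAvg (P := P) (j := i) (expMeanLogSU (n := Fin N))) j (γ t) c = W j c := by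
  obtain ⟨γ, h0, hvel, hfib'⟩ := exists_fibreCurve_of_chainFree ht₀ hst hstδ D.hk (fun j => {b | D.LamBond j b}) W (U := U) hsm
    (fun j _ c hc => hfib j c hc) (chainFree_lamBond D) (X := X) (fun j _ c hc => hX j c hc)
  exact ⟨γ, h0, hvel, hfib'.mono fun t ht j c hc => ht j (D.le_of_lamBond hc) c hc⟩

end Ascend

/-! ## §3  At NODE 00's objects: the tangent and current forms on print's multi-scale fibre; dictionary with the tree's pins -/

section Record

variable {F : T4Family} {N : ℕ} [NeZero N]

/-- ★★★ **CURVE-CRITICAL ON PRINT'S (2.3) MULTI-SCALE FIBRE ⇒ TANGENT-CRITICAL ON THE JOINT KERNEL — NO CHART, NO CORRECTOR, NO CHAIN HYPOTHESIS** (NODE 00's objects: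
`SU(N)`, the `K`-th torus, the averaging of record; `D : Domains (F.P K)`).  `U` lies on the fibre «`Ū^j(U) = W_j` on `Λ_j`» with `t₀`-small iterated averages below
`k`; `U` is a critical configuration of (5) on that fibre in the CURVE form (the text of `IsCritOnFibre` with the (2.3) constraint, spelled out); then for every
joint-kernel direction `X`, `d∕dt A(U·exp(tX))∣_{t=0} = 0` — print's (82) on the multi-scale tangent space (83).
[cite: Balaban1985Variational, p.277, (3),(5)–(7) p.278, (82)–(83) p.290, p.300, Prop. 8 p.304; Balaban1984PropagatorsII, (2.3) p.224; Balaban1988Convergent, (2.10)–(2.12) p.256] -/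
theorem hasDerivAt_wilsonAction4_expChart_of_critLam {K : ℕ} (D : Domains (F.P K)) {t₀ : ℝ} (ht₀ : 0 < t₀)
    (hst : stokesConst (F.P K) * t₀ < emlWeight (F.P K) / 16) (hstδ : stokesConst (F.P K) * t₀ < deltaSU (Fin N))
    {W : MSField (F.P K) (SU N)} {U : GaugeField (F.P K) 0 (SU N)}
    (hsm : ∀ i, i < D.k → PlaqSmall t₀ (avgFamily (avOfRecord F N K) U i))
    (hfib : ∀ j (c : PBond (F.P K) j), D.LamBond j c → avgFamily (avOfRecord F N K) U j c = W j c)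
    (hcrit : ∀ γ : ℝ → GaugeField (F.P K) 0 (SU N), γ 0 = U →
      DifferentiableAt ℝ (fun (t : ℝ) (b : PBond (F.P K) 0) => ((γ t b : SU N) : Matrix (Fin N) (Fin N) ℂ)) 0 →
        (∀ᶠ t in 𝓝 (0 : ℝ), ∀ j (c : PBond (F.P K) j), D.LamBond j c → avgFamily (avOfRecord F N K) (γ t) j c = W j c) →
          ∀ a : ℝ, HasDerivAt (fun t => wilsonAction4 (γ t)) a 0 → a = 0)
    {X : PBond (F.P K) 0 → lieSU (Fin N)}
    (hX : ∀ j (c : PBond (F.P K) j), D.LamBond j c → HasDerivAt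
      (fun t : ℝ => ((avgFamily (avOfRecord F N K) (expChart U (t • X)) j c : SU N) : Matrix (Fin N) (Fin N) ℂ)) 0 0) :
    HasDerivAt (fun t : ℝ => wilsonAction4 (expChart U (t • X))) 0 0 := by
  obtain ⟨γ, hγ0, hγvel, hγfib⟩ := exists_fibreCurve_of_lamBond (P := F.P K) ht₀ hst hstδ D W (U := U) hsm hfib (X := X) hX
  have h₂ : ∀ b, HasDerivAt (fun t : ℝ => ((expChart U (t • X) b : SU N) : Matrix (Fin N) (Fin N) ℂ))
      ((U b : Matrix (Fin N) (Fin N) ℂ) * (X b : Matrix (Fin N) (Fin N) ℂ)) 0 :=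
    hasDerivAt_coe_expChart_along (U := U) (c := fun t : ℝ => t • X) (hasDerivAt_ray X) (zero_smul ℝ X)
  have h12 : γ 0 = (fun t : ℝ => expChart U (t • X)) 0 := by
    show γ 0 = expChart U ((0 : ℝ) • X)
    rw [hγ0, zero_smul, expChart_zero]
  have hd : DifferentiableAt ℝ (fun (t : ℝ) (b : PBond (F.P K) 0) => ((γ t b : SU N) : Matrix (Fin N) (Fin N) ℂ)) 0 :=
    (hasDerivAt_pi.2 hγvel).differentiableAt
  have ha := hasDerivAt_wilsonAction4 hγvel (fun p => hasDerivAt_coe_plaqHol hγvel p)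
  have ha0 := hcrit γ hγ0 hd hγfib _ ha
  rw [ha0] at ha
  exact hasDerivAt_wilsonAction4_of_sameVelocity h12 hγvel h₂ ha

/-- The conclusion as the vanishing of the plain derivative. [cite: Balaban1985Variational, (82) p.290 (bookkeeping)] -/
theorem deriv_wilsonAction4_expChart_eq_zero_of_critLam {K : ℕ} (D : Domains (F.P K)) {t₀ : ℝ} (ht₀ : 0 < t₀)
    (hst : stokesConst (F.P K) * t₀ < emlWeight (F.P K) / 16) (hstδ : stokesConst (F.P K) * t₀ < deltaSU (Fin N))
    {W : MSField (F.P K) (SU N)} {U : GaugeField (F.P K) 0 (SU N)}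
    (hsm : ∀ i, i < D.k → PlaqSmall t₀ (avgFamily (avOfRecord F N K) U i))
    (hfib : ∀ j (c : PBond (F.P K) j), D.LamBond j c → avgFamily (avOfRecord F N K) U j c = W j c)
    (hcrit : ∀ γ : ℝ → GaugeField (F.P K) 0 (SU N), γ 0 = U →
      DifferentiableAt ℝ (fun (t : ℝ) (b : PBond (F.P K) 0) => ((γ t b : SU N) : Matrix (Fin N) (Fin N) ℂ)) 0 →
        (∀ᶠ t in 𝓝 (0 : ℝ), ∀ j (c : PBond (F.P K) j), D.LamBond j c → avgFamily (avOfRecord F N K) (γ t) j c = W j c) →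
          ∀ a : ℝ, HasDerivAt (fun t => wilsonAction4 (γ t)) a 0 → a = 0)
    {X : PBond (F.P K) 0 → lieSU (Fin N)}
    (hX : ∀ j (c : PBond (F.P K) j), D.LamBond j c → HasDerivAt
      (fun t : ℝ => ((avgFamily (avOfRecord F N K) (expChart U (t • X)) j c : SU N) : Matrix (Fin N) (Fin N) ℂ)) 0 0) :
    deriv (fun t : ℝ => wilsonAction4 (expChart U (t • X))) 0 = 0 :=
  (hasDerivAt_wilsonAction4_expChart_of_critLam D ht₀ hst hstδ hsm hfib hcrit hX).deriv

/-- ★★★ **THE MULTI-SCALE EULER–LAGRANGE EQUATION IN CURRENT FORM ON PRINT'S FIBRE**: under the same hypotheses, for every joint-kernel direction `X` and every `η ≠ 0`,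
`Σ_b Re Tr(U_bX_bU_b⋆ · η·(D^{η*}_U∂U)(b)) = 0` ([15] (141) in [B8] (1.2)'s letters; 35g's `sum_re_trace_covDivT_eq_zero_of_hasDerivAt_zero`).
[cite: Balaban1985Variational, (82)–(83) p.290, (141) p.299, p.300; Balaban1985RegularSpaces, (1.1)–(1.2) p.76; Balaban1984PropagatorsII, (2.3) p.224] -/
theorem sum_re_trace_covDivT_eq_zero_of_critLam {K : ℕ} (D : Domains (F.P K)) {t₀ : ℝ} (ht₀ : 0 < t₀)
    (hst : stokesConst (F.P K) * t₀ < emlWeight (F.P K) / 16) (hstδ : stokesConst (F.P K) * t₀ < deltaSU (Fin N))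
    {W : MSField (F.P K) (SU N)} {U : GaugeField (F.P K) 0 (SU N)}
    (hsm : ∀ i, i < D.k → PlaqSmall t₀ (avgFamily (avOfRecord F N K) U i))
    (hfib : ∀ j (c : PBond (F.P K) j), D.LamBond j c → avgFamily (avOfRecord F N K) U j c = W j c)
    (hcrit : ∀ γ : ℝ → GaugeField (F.P K) 0 (SU N), γ 0 = U →
      DifferentiableAt ℝ (fun (t : ℝ) (b : PBond (F.P K) 0) => ((γ t b : SU N) : Matrix (Fin N) (Fin N) ℂ)) 0 →
        (∀ᶠ t in 𝓝 (0 : ℝ), ∀ j (c : PBond (F.P K) j), D.LamBond j c → avgFamily (avOfRecord F N K) (γ t) j c = W j c) →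
          ∀ a : ℝ, HasDerivAt (fun t => wilsonAction4 (γ t)) a 0 → a = 0)
    {X : PBond (F.P K) 0 → lieSU (Fin N)}
    (hX : ∀ j (c : PBond (F.P K) j), D.LamBond j c → HasDerivAt
      (fun t : ℝ => ((avgFamily (avOfRecord F N K) (expChart U (t • X)) j c : SU N) : Matrix (Fin N) (Fin N) ℂ)) 0 0)
    {η : ℝ} (hη : η ≠ 0) :
    ∑ b : PBond (F.P K) 0, (Matrix.trace ((U b : Matrix (Fin N) (Fin N) ℂ) * (X b : Matrix (Fin N) (Fin N) ℂ) * star (U b : Matrix (Fin N) (Fin N) ℂ) *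
      (η • covDivT η (unitsField (toUField U)) b.dir b.src))).re = 0 :=
  sum_re_trace_covDivT_eq_zero_of_hasDerivAt_zero U X hη (hasDerivAt_wilsonAction4_expChart_of_critLam D ht₀ hst hstδ hsm hfib hcrit hX)

/-- ★ **DICTIONARY WITH STUB 1's PIN: CRITICAL ON PRINT'S FIBRE ⇒ `IsCritOnFibre` ON THE (b) FIBRE OF `genSet`.**  Every (2.3)-bond meets `Γ_j` (n07-w2
`mem_bondsOf_genSet_inOm_of_lamBond`), so the (b) fibre `{U | AgreeOn (genSet Ω k) (Ū(U)) W}` of [III] (2.2)'s determining set (the tree's `bondsOf`, bonds MEETING `Γ_j`)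
is CONTAINED in print's fibre; a configuration critical along every curve in the larger fibre is critical along every curve in the smaller one.  (The converse
inclusion fails at the `Γ_j ↔ Ω_{j+1}` connectors — `GenSetVsLamBond.mem_bondsOf_genSet_inOm_and_not_lamBond_iff`.)
[cite: Balaban1988Convergent, (2.2), (2.10)–(2.12) pp.255–256; Balaban1984PropagatorsII, (2.3) p.224; Balaban1985Variational, (7) p.278, Prop. 8 p.304] -/
theorem isCritOnFibre_genSet_of_critLam {K : ℕ} (D : Domains (F.P K)) {W : MSField (F.P K) (SU N)} {U : GaugeField (F.P K) 0 (SU N)}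
    (hcrit : ∀ γ : ℝ → GaugeField (F.P K) 0 (SU N), γ 0 = U →
      DifferentiableAt ℝ (fun (t : ℝ) (b : PBond (F.P K) 0) => ((γ t b : SU N) : Matrix (Fin N) (Fin N) ℂ)) 0 →
        (∀ᶠ t in 𝓝 (0 : ℝ), ∀ j (c : PBond (F.P K) j), D.LamBond j c → avgFamily (avOfRecord F N K) (γ t) j c = W j c) →
          ∀ a : ℝ, HasDerivAt (fun t => wilsonAction4 (γ t)) a 0 → a = 0) :
    IsCritOnFibre F N K (genSet (fun i => {x : Site (F.P K) 0 | D.InOm i x}) D.k) W U :=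
  fun γ hγ0 hd hfib a ha => hcrit γ hγ0 hd (hfib.mono fun _ ht j _ hc => ht j _ (mem_bondsOf_genSet_inOm_of_lamBond D hc)) a ha

/-- ★ **CONSISTENCY WITH THE ONE-SCALE PIN.**  With all domains the whole torus up to level `k` (`Domains.whole k`, [B6] p.224's admitted case) print's (2.3) fibre is
`𝔅_k(W_k) = {U | Ū^k(U) = W_k}` and curve-criticality on it IS g2's `IsCritOfRecord F N K k (W k) U` — the setting of 35c∕35e.
[cite: Balaban1984PropagatorsII, (2.1), (2.3) p.224; Balaban1985Variational, (3),(5) p.278] -/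
theorem critLam_whole_iff {K k : ℕ} (hk : k ≤ (F.P K).m + (F.P K).K) {W : MSField (F.P K) (SU N)} {U : GaugeField (F.P K) 0 (SU N)} :
    (∀ γ : ℝ → GaugeField (F.P K) 0 (SU N), γ 0 = U →
      DifferentiableAt ℝ (fun (t : ℝ) (b : PBond (F.P K) 0) => ((γ t b : SU N) : Matrix (Fin N) (Fin N) ℂ)) 0 →
        (∀ᶠ t in 𝓝 (0 : ℝ), ∀ j (c : PBond (F.P K) j), (Domains.whole k hk).LamBond j c → avgFamily (avOfRecord F N K) (γ t) j c = W j c) →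
          ∀ a : ℝ, HasDerivAt (fun t => wilsonAction4 (γ t)) a 0 → a = 0) ↔
    IsCritOfRecord F N K k (W k) U := by
  have key : ∀ V : GaugeField (F.P K) 0 (SU N),
      (∀ j (c : PBond (F.P K) j), (Domains.whole k hk).LamBond j c → avgFamily (avOfRecord F N K) V j c = W j c) ↔
        Averaging.iter (avOfRecord F N K) k V = W k := by
    intro V
    constructor
    · intro h
      funext c
      exact h k c ((lamBond_whole_iff hk c).2 rfl)
    · intro h j c hc
      obtain rfl := (lamBond_whole_iff hk c).1 hc
      exact congrFun h c
  simp only [IsCritOfRecord, key]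

end Record

end Summit.QuantumFields.YangMills.BalabanUVNodes.N07CritMultiScaleLamBond

end
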